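import Mathlib
import Summits.KontsevichZagierPeriods.Zeta5Search.BrickDigitStripCirc
import Summits.KontsevichZagierPeriods.Zeta5Search.BrickLambda
import Summits.KontsevichZagierPeriods.Zeta5Search.GaussWilsonBlock

/-!
# BrickLambdaCirc — the valuation of the multiplier of a ° cell: «every gained member is paid for with its
multiplicity», `v_p(λ_j) = B·c_a(1 + v(y_a)) + B·c_b(1 + v(y_b)) + ε·c_c(1 + v(y_c))` (zi-p2 THEOREM 7 (2.2)–(2.3)
for `c_h = 0`; cell zeta5-irr)

HONEST FRAMING: systematic search; no irrationality claim unless certified. INSTRUMENT lemma of the ζ(5)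
census cell zeta5-irr (HOME `run/shared/lean/pub/zeta5-irr/`; memo `zi-p2/probes/B8/thm7/THEOREM7.md` §2 LEMMA 2
«VALUATION OF λ_K (Legendre digit-stripping; exact) … (2.2) C(N,K)/C(N′,K′) = [p·y_h]^{c_h}·ρ₁°, C(N+K,K)/C(N′+K′,K′) =
[p·y_a]^{c_a}·ρ₂°, C(2N−K,N)/C(2N′−K′,N′) = [p·y_b]^{[δ_b=1]}·…·ρ₃° … (2.3) … CASE δ_b ≠ −1 … (2.3) reads v(λ_K) =
Σ_i m_i(1 + v(y_i))»; design note HOME `zi-eng/lean-g8/DESIGN-LEMMA2-TYPES.md` (Λ1)). Nothing here is about ζ(5); no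
irrationality content; filing moves no rung. Filed by the engine seat zi-eng (g9); sequel of `BrickDigitStripCirc`
(the boundary polynomial `carryPoly` and the constant `a` of (★)), `BlockRatioBinomial` (zi-eng g7: the carry-free
block valuation `v(C((M+e)p+(d+f), Mp+d)) = v(C(M+e,M))`, `d + f < p`) and `GaussWilsonBlock.legendre_digit_strip`.

## The statements (valuations only; the unit parts are not needed for LEMMA 2)

`p` an odd prime; ° cell `n = n₀ + Np`, `j = j₀ + Jp`, `j₀ ≤ n₀ < p`, `J ≤ N`; carries `c_a = (n₀+j₀)/p`,
`c_b = (n₀+(n₀−j₀))/p`, `c_c = centreCarry p n j`; `m := B c_a + B c_b + ε c_c` = the degree of `carryPoly`.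
* `padicValNat_choose_block_carry`: **`v(C((M+e)p + (d+f), Mp+d)) = v(C(M+e,M)) + 1 + v(M+e+1)`** for digits
  `d, f < p ≤ d + f` (THE CARRY TWIN of the block-ratio valuation; Legendre three times).
* `padicValNat_choose_circ`: `v(C(n,j)) = v(C(N,J))`; `padicValNat_choose_add_circ`: `v(C(n+j,j)) = v(C(N+J,J)) +
  c_a(1 + v(N+J+1))`; `padicValNat_choose_two_sub_circ`: `v(C(2n−j,n)) = v(C(2N−J,N)) + c_b(1 + v(2N−J+1))` — (2.2).
* `padicValuation_cTop_eq`: the product formula for `v(cTop A B ε n K)` (every `ε`).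
* **`padicValuation_cTop_circ`**: `v(cTop A B ε n j) = exp(−m)·v(carryPoly(0))·v(cTop A B 0 N J)` — (2.3) in the form
  `λ_j = a·E_j(0)`, `v_p(a) = m`; and **`padicValuation_stripConst`**: the constant `a` of
  `BrickDigitStripCirc.laurentSeries_rescale_eq_circ` has `v(a) = exp(−m)` EXACTLY (off the exact centre).
-/

namespace Summit.KontsevichZagierPeriods.Zeta5Search.BrickLambdaCirc

open Finset Nat Polynomial WithZero
open Summit.KontsevichZagierPeriods.Zeta5Search.BrickTopCoefficient (cTop)
open Summit.KontsevichZagierPeriods.Zeta5Search.BrickLaurent (laurent laurent_zero)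
open Summit.KontsevichZagierPeriods.Zeta5Search.BrickLaurentValuation (padicValuation_natCast)
open Summit.KontsevichZagierPeriods.Zeta5Search.BlockRatioBinomial (padicValNat_choose_block)
open Summit.KontsevichZagierPeriods.Zeta5Search.BrickLambda (padicValuation_two cTop_zero_ne_zero)
open Summit.KontsevichZagierPeriods.Zeta5Search.GaussWilsonBlock (legendre_digit_strip)
open Summit.KontsevichZagierPeriods.Zeta5Search.BrickDigitStrip (padicValuation_intCast_eq_one_of)
open Summit.KontsevichZagierPeriods.Zeta5Search.BrickDigitStripCarry (centre_ne_zero div_two_carry_le_one)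
open Summit.KontsevichZagierPeriods.Zeta5Search.BrickDigitStripCirc (centreCarry carryPoly carryPoly_eval_zero_ne_zero)

noncomputable section

variable {p : ℕ} [Fact p.Prime]

/-! ## The block binomial with a carry (Legendre digit-stripping) -/

/-- `v(C(i+j, j)) + v(i!) + v(j!) = v((i+j)!)`. -/
theorem padicValNat_add_choose (i j : ℕ) :
    padicValNat p ((i + j).choose j) + padicValNat p i ! + padicValNat p j ! = padicValNat p (i + j)! := by
  have h := Nat.add_choose_mul_factorial_mul_factorial i j
  have hc : (i + j).choose j ≠ 0 := (Nat.choose_pos (Nat.le_add_left j i)).ne'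
  rw [← h, padicValNat.mul (mul_ne_zero hc (factorial_ne_zero i)) (factorial_ne_zero j), padicValNat.mul hc
    (factorial_ne_zero i)]

/-- **THE CARRY TWIN of the block-ratio valuation**: for digits `d, f < p` with a carry `p ≤ d + f`,
`v_p(C((M+e)p + (d+f), Mp+d)) = v_p(C(M+e, M)) + 1 + v_p(M+e+1)` (THEOREM 7 (2.2): the gained member
`y = M+e+1` is paid for, `C(N+K,K)/C(N′+K′,K′) = [p·y_a]^{c_a}·ρ₂°`). -/
theorem padicValNat_choose_block_carry (M e : ℕ) {d f : ℕ} (hd : d < p) (hf : f < p) (hdf : p ≤ d + f) :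
    padicValNat p (((M + e) * p + (d + f)).choose (M * p + d)) =
      padicValNat p ((M + e).choose M) + 1 + padicValNat p (M + e + 1) := by
  have hba : (M + e) * p + (d + f) = (e * p + f) + (M * p + d) := by ring
  rw [hba]
  have h1 := padicValNat_add_choose (p := p) (e * p + f) (M * p + d)
  have hva : padicValNat p (M * p + d)! = M + padicValNat p M ! := by
    rw [mul_comm]; exact legendre_digit_strip p M d hd
  have hvb : padicValNat p (e * p + f)! = e + padicValNat p e ! := by
    rw [mul_comm]; exact legendre_digit_strip p e f hf
  have hvab : padicValNat p ((e * p + f) + (M * p + d))! = (M + e + 1) + padicValNat p (M + e + 1)! := by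
    have : (e * p + f) + (M * p + d) = p * (M + e + 1) + (d + f - p) := by
      zify [hdf]; ring
    rw [this]; exact legendre_digit_strip p (M + e + 1) (d + f - p) (by omega)
  have hfs : padicValNat p (M + e + 1)! = padicValNat p (M + e + 1) + padicValNat p (M + e)! := by
    rw [Nat.factorial_succ, padicValNat.mul (by omega) (factorial_ne_zero _)]
  have hce := padicValNat_add_choose (p := p) e M
  rw [add_comm e M] at hce
  omega

/-! ## (2.2): the three binomial ratios of a ° cell -/

section circ

variable {N n₀ J j₀ : ℕ} (hn₀ : n₀ < p) (hj₀ : j₀ ≤ n₀) (hJN : J ≤ N)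
include hn₀ hj₀ hJN

/-- `v(C(n,j)) = v(C(N,J))` (no carry in `K + (N−K)` at digit `0` for a ° cell). -/
theorem padicValNat_choose_circ :
    padicValNat p ((n₀ + N * p).choose (j₀ + J * p)) = padicValNat p (N.choose J) := by
  have hp : p.Prime := Fact.out
  have h := padicValNat_choose_block hp J (N - J) (d := j₀) (f := n₀ - j₀) (by omega)
  rw [show J + (N - J) = N by omega, show j₀ + (n₀ - j₀) = n₀ by omega] at h
  rw [show n₀ + N * p = N * p + n₀ by ring, show j₀ + J * p = J * p + j₀ by ring, h]

omit hJN in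
/-- `v(C(n+j,j)) = v(C(N+J,J)) + c_a·(1 + v(N+J+1))`, `c_a = (n₀+j₀)/p` (the gained member `y_a = N+J+1`). -/
theorem padicValNat_choose_add_circ :
    padicValNat p ((n₀ + N * p + (j₀ + J * p)).choose (j₀ + J * p)) =
      padicValNat p ((N + J).choose J) + (n₀ + j₀) / p * (1 + padicValNat p (N + J + 1)) := by
  have hp : p.Prime := Fact.out
  have e1 : n₀ + N * p + (j₀ + J * p) = (J + N) * p + (j₀ + n₀) := by ring
  have e2 : j₀ + J * p = J * p + j₀ := by ring
  by_cases h : n₀ + j₀ < p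
  · rw [Nat.div_eq_of_lt h, zero_mul, add_zero, e1, e2, padicValNat_choose_block hp J N (by omega), add_comm J N]
  · have hca : (n₀ + j₀) / p = 1 :=
      le_antisymm (div_two_carry_le_one hn₀ (by omega)) ((Nat.one_le_div_iff hp.pos).2 (by omega))
    rw [hca, one_mul, e1, e2, padicValNat_choose_block_carry J N (by omega) hn₀ (by omega), add_comm J N, add_assoc]

/-- `v(C(2n−j,n)) = v(C(2N−J,N)) + c_b·(1 + v(2N−J+1))`, `c_b = (n₀+(n₀−j₀))/p` (the gained member `y_b = 2N−J+1`). -/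
theorem padicValNat_choose_two_sub_circ :
    padicValNat p ((2 * (n₀ + N * p) - (j₀ + J * p)).choose (n₀ + N * p)) =
      padicValNat p ((2 * N - J).choose N) + (n₀ + (n₀ - j₀)) / p * (1 + padicValNat p (2 * N - J + 1)) := by
  have hp : p.Prime := Fact.out
  have e1 : 2 * (n₀ + N * p) - (j₀ + J * p) = (N + (N - J)) * p + (n₀ + (n₀ - j₀)) := by
    zify [hj₀, hJN, show j₀ + J * p ≤ 2 * (n₀ + N * p) by nlinarith]
    ring
  have e2 : n₀ + N * p = N * p + n₀ := by ring
  have e3 : N + (N - J) = 2 * N - J := by omega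
  by_cases h : n₀ + (n₀ - j₀) < p
  · rw [Nat.div_eq_of_lt h, zero_mul, add_zero, e1, e2, padicValNat_choose_block hp N (N - J) (d := n₀)
      (f := n₀ - j₀) h, e3]
  · have hcb : (n₀ + (n₀ - j₀)) / p = 1 :=
      le_antisymm (div_two_carry_le_one hn₀ (by omega)) ((Nat.one_le_div_iff hp.pos).2 (by omega))
    rw [hcb, one_mul, e1, e2, padicValNat_choose_block_carry N (N - J) hn₀ (by omega) (by omega), e3,
      show 2 * N - J + 1 = N + (N - J) + 1 by omega, add_assoc]

end circ

/-! ## (2.3): the valuation of `c_{j,A}(n)` against `c̃_{J,A}(N)` -/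

/-- The product formula `v(cTop A B ε n K) = v(n/2 − K)^ε·v(C(n,K))^A·(v(C(n+K,K))·v(C(2n−K,n)))^B`. -/
theorem padicValuation_cTop_eq (A B ε n K : ℕ) : Rat.padicValuation p (cTop A B ε n K) =
    Rat.padicValuation p ((n : ℚ) / 2 - K) ^ ε * Rat.padicValuation p (n.choose K : ℚ) ^ A *
      (Rat.padicValuation p ((n + K).choose K : ℚ) * Rat.padicValuation p ((2 * n - K).choose n : ℚ)) ^ B := by
  unfold cTop
  rw [map_mul, map_mul, map_mul, map_pow, Valuation.map_neg, map_one, one_pow, one_mul, map_pow, map_pow, map_pow,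
    map_mul]

/-- The centre offset is a unit when `p ∤ n − 2K` (odd `p`). -/
theorem padicValuation_centre_eq_one (hp2 : p ≠ 2) {n K : ℕ} (h : ¬ (p : ℤ) ∣ (n : ℤ) - 2 * K) :
    Rat.padicValuation p ((n : ℚ) / 2 - K) = 1 := by
  rw [show (n : ℚ) / 2 - K = (((n : ℤ) - 2 * K : ℤ) : ℚ) / 2 by push_cast; ring, map_div₀, padicValuation_two hp2,
    div_one]
  exact padicValuation_intCast_eq_one_of h

/-- The centre offset against the centre member: `v(n/2 − j)^ε = (exp(−1)·v(y_c))^{ε·c_c}`, `y_c = (n/2−j)/p`. -/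
theorem padicValuation_centre_pow (hp2 : p ≠ 2) (ε n j : ℕ) :
    Rat.padicValuation p ((n : ℚ) / 2 - j) ^ ε =
      (exp (-1 : ℤ) * Rat.padicValuation p (((n : ℚ) / 2 - j) / p)) ^ (ε * centreCarry p n j) := by
  have hp : p.Prime := Fact.out
  have hpQ : (p : ℚ) ≠ 0 := by exact_mod_cast hp.ne_zero
  unfold centreCarry
  split_ifs with h
  · rw [mul_one, map_div₀, Rat.padicValuation_self, mul_div_cancel₀ _ exp_ne_zero]
  · rw [padicValuation_centre_eq_one hp2 h, one_pow, mul_zero, pow_zero]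

/-- Exponent bookkeeping: `exp(−(u + c(1+w))) = exp(−u)·(exp(−1)·exp(−w))^c`. -/
theorem exp_neg_add_mul (u w c : ℕ) :
    exp (-((u + c * (1 + w) : ℕ) : ℤ)) = exp (-(u : ℤ)) * (exp (-1 : ℤ) * exp (-(w : ℤ))) ^ c := by
  rw [← exp_add, ← exp_nsmul, ← exp_add, nsmul_eq_mul]
  congr 1; push_cast; ring

/-- `exp(−m) = exp(−1)^m`. -/
theorem exp_neg_natCast (m : ℕ) : exp (-(m : ℤ)) = exp (-1 : ℤ) ^ m := by
  rw [← exp_nsmul, nsmul_eq_mul, mul_neg_one]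

/-- Commutative-monoid bookkeeping behind (2.3): collecting the paid members. -/
theorem paid_members_bookkeeping {M : Type*} [CommMonoid M] (e c X Y Z ya yb yc : M) (A B ε ca cb cc : ℕ)
    (hc : c ^ ε = (e * yc) ^ (ε * cc)) :
    c ^ ε * X ^ A * (Y * (e * ya) ^ ca * (Z * (e * yb) ^ cb)) ^ B =
      e ^ (B * ca + B * cb + ε * cc) * (ya ^ (B * ca) * yb ^ (B * cb) * yc ^ (ε * cc)) * (X ^ A * (Y * Z) ^ B) := by
  rw [hc]
  simp only [mul_pow, ← pow_mul, pow_add]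
  rw [mul_comm ca B, mul_comm cb B]
  simp only [mul_comm, mul_assoc, mul_left_comm]

section lam

variable (hp2 : p ≠ 2) {A B ε N n₀ J j₀ : ℕ} (hn₀ : n₀ < p) (hj₀ : j₀ ≤ n₀) (hJN : J ≤ N)
include hJN

omit [Fact p.Prime] in
/-- The boundary polynomial at `0`: `E_j(0) = (−y_a)^{B c_a}·y_b^{B c_b}·y_c^{ε c_c}`. -/
theorem carryPoly_eval_zero :
    (carryPoly p B ε N n₀ J j₀).eval 0 = (-((N + J + 1 : ℕ) : ℚ)) ^ (B * ((n₀ + j₀) / p)) *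
      ((2 * N - J + 1 : ℕ) : ℚ) ^ (B * ((n₀ + (n₀ - j₀)) / p)) *
      (((((n₀ + N * p : ℕ) : ℚ)) / 2 - ((j₀ + J * p : ℕ) : ℚ)) / p) ^ (ε * centreCarry p (n₀ + N * p) (j₀ + J * p)) := by
  unfold carryPoly
  simp only [eval_mul, eval_pow, eval_add, eval_X, eval_C, zero_add]
  have e1 : ((N + J + 1 : ℕ) : ℚ) = (J : ℚ) + ((N + 1 : ℕ) : ℚ) := by push_cast; ring
  have e2 : ((2 * N - J + 1 : ℕ) : ℚ) = (N : ℚ) + ((N + 1 : ℕ) : ℚ) - J := by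
    push_cast [show J ≤ 2 * N by omega]; ring
  rw [e1, e2]

/-- `v(E_j(0)) = v(y_a)^{B c_a}·v(y_b)^{B c_b}·v(y_c)^{ε c_c}`. -/
theorem padicValuation_carryPoly_eval_zero :
    Rat.padicValuation p ((carryPoly p B ε N n₀ J j₀).eval 0) =
      Rat.padicValuation p ((N + J + 1 : ℕ) : ℚ) ^ (B * ((n₀ + j₀) / p)) *
        Rat.padicValuation p ((2 * N - J + 1 : ℕ) : ℚ) ^ (B * ((n₀ + (n₀ - j₀)) / p)) *
        Rat.padicValuation p (((((n₀ + N * p : ℕ) : ℚ)) / 2 - ((j₀ + J * p : ℕ) : ℚ)) / p) ^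
          (ε * centreCarry p (n₀ + N * p) (j₀ + J * p)) := by
  rw [carryPoly_eval_zero hJN, map_mul, map_mul, map_pow, map_pow, map_pow, Valuation.map_neg]

include hp2 hn₀ hj₀

/-- **(2.3) for a ° cell**: `v(c_{j,A}(n)) = exp(−m)·v(E_j(0))·v(c̃_{J,A}(N))`, `m = B c_a + B c_b + ε c_c`,
`E_j = carryPoly` («every gained member is paid for with its multiplicity»). -/
theorem padicValuation_cTop_circ :
    Rat.padicValuation p (cTop A B ε (n₀ + N * p) (j₀ + J * p)) =
      exp (-((B * ((n₀ + j₀) / p) + B * ((n₀ + (n₀ - j₀)) / p) +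
          ε * centreCarry p (n₀ + N * p) (j₀ + J * p) : ℕ) : ℤ)) *
        Rat.padicValuation p ((carryPoly p B ε N n₀ J j₀).eval 0) * Rat.padicValuation p (cTop A B 0 N J) := by
  have hp : p.Prime := Fact.out
  have hJp : J * p ≤ N * p := Nat.mul_le_mul_right _ hJN
  -- valuations of the naturals, (2.2)
  have hX : Rat.padicValuation p (((n₀ + N * p).choose (j₀ + J * p) : ℕ) : ℚ) =
      Rat.padicValuation p ((N.choose J : ℕ) : ℚ) := by
    rw [padicValuation_natCast (Nat.choose_pos (by nlinarith)).ne', padicValuation_natCast (Nat.choose_pos hJN).ne',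
      padicValNat_choose_circ hn₀ hj₀ hJN]
  have hY : Rat.padicValuation p (((n₀ + N * p + (j₀ + J * p)).choose (j₀ + J * p) : ℕ) : ℚ) =
      Rat.padicValuation p (((N + J).choose J : ℕ) : ℚ) *
        (exp (-1 : ℤ) * Rat.padicValuation p ((N + J + 1 : ℕ) : ℚ)) ^ ((n₀ + j₀) / p) := by
    rw [padicValuation_natCast (Nat.choose_pos (Nat.le_add_left _ _)).ne',
      padicValuation_natCast (Nat.choose_pos (Nat.le_add_left _ _)).ne', padicValuation_natCast (by omega),
      padicValNat_choose_add_circ hn₀ hj₀, exp_neg_add_mul]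
  have hZ : Rat.padicValuation p (((2 * (n₀ + N * p) - (j₀ + J * p)).choose (n₀ + N * p) : ℕ) : ℚ) =
      Rat.padicValuation p (((2 * N - J).choose N : ℕ) : ℚ) *
        (exp (-1 : ℤ) * Rat.padicValuation p ((2 * N - J + 1 : ℕ) : ℚ)) ^ ((n₀ + (n₀ - j₀)) / p) := by
    rw [padicValuation_natCast (Nat.choose_pos (by omega)).ne', padicValuation_natCast (Nat.choose_pos (by omega)).ne',
      padicValuation_natCast (by omega), padicValNat_choose_two_sub_circ hn₀ hj₀ hJN, exp_neg_add_mul]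
  have h0 : Rat.padicValuation p (cTop A B 0 N J) = Rat.padicValuation p ((N.choose J : ℕ) : ℚ) ^ A *
      (Rat.padicValuation p (((N + J).choose J : ℕ) : ℚ) * Rat.padicValuation p (((2 * N - J).choose N : ℕ) : ℚ)) ^ B := by
    rw [padicValuation_cTop_eq, pow_zero, one_mul]
  rw [h0, padicValuation_carryPoly_eval_zero hJN, padicValuation_cTop_eq, hX, hY, hZ, exp_neg_natCast]
  exact paid_members_bookkeeping _ _ _ _ _ _ _ _ A B ε _ _ _ (padicValuation_centre_pow hp2 ε _ _)

/-- **The constant of (★) has `v_p(a) = m` EXACTLY**: if `a·E_j(0)·laurent A B 0 N J 0 = laurent A B ε n j 0`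
(as in `BrickDigitStripCirc.laurentSeries_rescale_eq_circ`) and the cell is off the exact centre (`2j ≠ n ∨ ε = 0`),
then `v(a) = exp(−(B c_a + B c_b + ε c_c))`; in particular `a ∈ ℤ_(p)` and `a ∈ pℤ_(p)` as soon as one carry occurs. -/
theorem padicValuation_stripConst (hAB : 2 * B ≤ A) {n j : ℕ} (hn : n = n₀ + N * p) (hj : j = j₀ + J * p)
    (hcen : 2 * j ≠ n ∨ ε = 0) {a : ℚ}
    (ha : a * (carryPoly p B ε N n₀ J j₀).eval 0 * laurent A B 0 N J 0 = laurent A B ε n j 0) :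
    Rat.padicValuation p a = exp (-((B * ((n₀ + j₀) / p) + B * ((n₀ + (n₀ - j₀)) / p) +
      ε * centreCarry p n j : ℕ) : ℤ)) := by
  subst hn hj
  have hjn : j₀ + J * p ≤ n₀ + N * p := by nlinarith
  rw [laurent_zero hAB 0 hJN, laurent_zero hAB ε hjn] at ha
  have hE0 : (carryPoly p B ε N n₀ J j₀).eval 0 ≠ 0 := carryPoly_eval_zero_ne_zero (p := p) hJN hcen
  have hT0 : cTop A B 0 N J ≠ 0 := cTop_zero_ne_zero hJN A B
  have hv := congrArg (Rat.padicValuation p) ha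
  rw [map_mul, map_mul, padicValuation_cTop_circ hp2 hn₀ hj₀ hJN, mul_assoc, mul_assoc] at hv
  have hne : Rat.padicValuation p ((carryPoly p B ε N n₀ J j₀).eval 0) * Rat.padicValuation p (cTop A B 0 N J) ≠ 0 :=
    mul_ne_zero ((Valuation.ne_zero_iff _).2 hE0) ((Valuation.ne_zero_iff _).2 hT0)
  exact mul_right_cancel₀ hne hv

end lam

end

end Summit.KontsevichZagierPeriods.Zeta5Search.BrickLambdaCirc
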